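import Mathlib
import Summits.NavierStokesRegularity.NavierStokesRegularity.Theorems.FilamentSkeletonRssStadiumDeviationReflect
import Summits.NavierStokesRegularity.NavierStokesRegularity.Theorems.FilamentSkeletonRssStadiumPartnerPiece

/-!
# Route `FilamentSkeletonRss` · child crux `TangentSkeletonNearStraightL` (stmt-NavierStokesRegularity-23320) · registered line
# `child_tangent_analytic_strip_L` (b0b56c52900dd90a), stub `stub_stripPropagation` — assembly: TRANSPORT OF THE CORNER CERTIFICATES TO EVERY TARGET

Item R3 of the quarter-width blueprint (evidence `CORNER-QUARTER-BLUEPRINT-leafhand-15-g0.md` v5 on 23320).  The pointwise certificates of the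
right output corner (`Theorems.StadiumCornerRightNear/…Foot/…DescentFoot/…DescentVariance/…DescentMid/…DescentFar`, `Theorems.StadiumCornerLeft`,
`Theorems.StadiumPlateauShortChord`) are stated for a target `z = x₀ + iY` with `0 ≤ Y < hs/4` and `cc ≤ x₀ < cc + L + hs/4`.  Every target of
the output stadium `{|Im z| < hs/4, |Re z − cc| < L + hs/4}` reduces to that case by two HOLOMORPHIC changes of the data that preserve all
stadium hypotheses of the stub (`F` holomorphic with `‖F′‖ ≤ 2`, `Σ (F′)ᵢ² = 1`, real trace `cplx ∘ X`, `X ∈ C¹` unit speed, tangent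
oscillation `≤ Rb`):
* `restrict_package` — RESTRICTION to the sub-stadium centred at the target abscissa, `cc' = x₀`, `L' = L − |x₀ − cc|` (then `cc' ≤ x₀`
  trivially and `x₀ < cc' + L' + hs/4` iff `|x₀ − cc| < L + hs/4`; `L' > −hs/4` is all the corner lemmas use);
* `reflect_package` — POINT REFLECTION `w ↦ 2x − w` through a real point (holomorphic, as in `Theorems.StadiumDeviationReflect`): the data
  `F ∘ (2x − ·)`, `X ∘ (2x − ·)`, centre `2x − cc` satisfy the same hypotheses, and `F(2x − w)` is the new `F` at `w` — with `x = x₀` a target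
  BELOW the axis becomes a target above it at the same abscissa (`reflect_target`), source heights flip with it, and the chord square
  `Σᵢ (Fᵢ(ζ) − Fᵢ(z))²` is literally unchanged (`reflect_chord_sq`).
HONEST FRAMING: bookkeeping for a HYPOTHETICAL filament skeleton on the NEGATIVE side of a MODEL route; the stub `stub_stripPropagation` is NOT
closed by this file; nothing here bears on Navier–Stokes regularity or blow-up.  `--supports stmt-NavierStokesRegularity-23320`.
-/

set_option linter.dupNamespace false

noncomputable section

namespace Summit.NavierStokesRegularity.NavierStokesRegularity.Theorems.StadiumCornerTransport

open Set Metric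
open scoped InnerProductSpace BigOperators
open Summit.NavierStokesRegularity.NavierStokesRegularity.Theorems.StadiumDeviationReflect
open Summit.NavierStokesRegularity.NavierStokesRegularity.Theorems.StadiumPartnerPiece

/-- **Restriction to a sub-stadium.**  If `[cc' − L' − hs, cc' + L' + hs] ⊆ [cc − L − hs, cc + L + hs]` then the stub's stadium hypotheses for
`(F, cc, L)` give those for `(F, cc', L')` (same `hs`, same `X`). [folklore] -/
theorem restrict_package {hs L cc L' cc' : ℝ} {F : ℂ → (Fin 3 → ℂ)}
    (hF : DifferentiableOn ℂ F {z : ℂ | |z.im| < hs ∧ |z.re - cc| < L + hs})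
    (hM : ∀ z ∈ {z : ℂ | |z.im| < hs ∧ |z.re - cc| < L + hs}, ‖deriv F z‖ ≤ 2)
    (hunit : ∀ w ∈ {z : ℂ | |z.im| < hs ∧ |z.re - cc| < L + hs}, ∑ i, (deriv F w i) ^ 2 = 1)
    {X : ℝ → EuclideanSpace ℝ (Fin 3)}
    (hFX : ∀ r : ℝ, (r : ℂ) ∈ {z : ℂ | |z.im| < hs ∧ |z.re - cc| < L + hs} →
      F r = fun i => ((⟪X r, EuclideanSpace.single i (1:ℝ)⟫_ℝ : ℝ) : ℂ))
    (hlo : cc - L ≤ cc' - L') (hhi : cc' + L' ≤ cc + L) :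
    DifferentiableOn ℂ F {z : ℂ | |z.im| < hs ∧ |z.re - cc'| < L' + hs} ∧
    (∀ z ∈ {z : ℂ | |z.im| < hs ∧ |z.re - cc'| < L' + hs}, ‖deriv F z‖ ≤ 2) ∧
    (∀ w ∈ {z : ℂ | |z.im| < hs ∧ |z.re - cc'| < L' + hs}, ∑ i, (deriv F w i) ^ 2 = 1) ∧
    (∀ r : ℝ, (r : ℂ) ∈ {z : ℂ | |z.im| < hs ∧ |z.re - cc'| < L' + hs} →
      F r = fun i => ((⟪X r, EuclideanSpace.single i (1:ℝ)⟫_ℝ : ℝ) : ℂ)) := by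
  have hsub : {z : ℂ | |z.im| < hs ∧ |z.re - cc'| < L' + hs} ⊆ {z : ℂ | |z.im| < hs ∧ |z.re - cc| < L + hs} := by
    rintro z ⟨h1, h2⟩
    refine ⟨h1, ?_⟩
    rw [abs_lt] at h2 ⊢
    constructor <;> linarith [h2.1, h2.2]
  exact ⟨hF.mono hsub, fun z hz => hM z (hsub hz), fun w hw => hunit w (hsub hw), fun r hr => hFX r (hsub hr)⟩

/-- The sub-stadium centred at a target abscissa: for `|x₀ − cc| < L + hs/4`, with `cc' = x₀`, `L' = L − |x₀ − cc|` the inclusion holds,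
`cc' ≤ x₀` and `x₀ < cc' + L' + hs/4`. [folklore] -/
theorem centre_at_target {hs L cc x₀ : ℝ} (hx₀ : |x₀ - cc| < L + hs / 4) :
    cc - L ≤ x₀ - (L - |x₀ - cc|) ∧ x₀ + (L - |x₀ - cc|) ≤ cc + L ∧ x₀ ≤ x₀ ∧ x₀ < x₀ + (L - |x₀ - cc|) + hs / 4 := by
  refine ⟨?_, ?_, le_rfl, by linarith⟩
  · have := neg_abs_le (x₀ - cc); linarith
  · have := le_abs_self (x₀ - cc); linarith

/-- **Point reflection through a real point.**  The data `F ∘ (2x − ·)`, `X ∘ (2x − ·)`, centre `2x − cc` satisfy the stub's stadium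
hypotheses whenever `(F, X, cc)` do (`‖F′‖ ≤ 2`, `Σ (F′)ᵢ² = 1`, real trace, `C¹` unit speed, tangent oscillation). [folklore] -/
theorem reflect_package {hs L cc x : ℝ} {F : ℂ → (Fin 3 → ℂ)}
    (hF : DifferentiableOn ℂ F {z : ℂ | |z.im| < hs ∧ |z.re - cc| < L + hs})
    (hM : ∀ z ∈ {z : ℂ | |z.im| < hs ∧ |z.re - cc| < L + hs}, ‖deriv F z‖ ≤ 2)
    (hunit : ∀ w ∈ {z : ℂ | |z.im| < hs ∧ |z.re - cc| < L + hs}, ∑ i, (deriv F w i) ^ 2 = 1)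
    {X : ℝ → EuclideanSpace ℝ (Fin 3)} (hX : ContDiff ℝ 1 X) (hXu : ∀ τ, ‖deriv X τ‖ = 1)
    {Rb : ℝ} (hosc : ∀ τ σ, ‖deriv X τ - deriv X σ‖ ≤ Rb)
    (hFX : ∀ r : ℝ, (r : ℂ) ∈ {z : ℂ | |z.im| < hs ∧ |z.re - cc| < L + hs} →
      F r = fun i => ((⟪X r, EuclideanSpace.single i (1:ℝ)⟫_ℝ : ℝ) : ℂ)) :
    DifferentiableOn ℂ (fun w => F (2 * (x : ℂ) - w)) {z : ℂ | |z.im| < hs ∧ |z.re - (2 * x - cc)| < L + hs} ∧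
    (∀ z ∈ {z : ℂ | |z.im| < hs ∧ |z.re - (2 * x - cc)| < L + hs}, ‖deriv (fun w => F (2 * (x : ℂ) - w)) z‖ ≤ 2) ∧
    (∀ w ∈ {z : ℂ | |z.im| < hs ∧ |z.re - (2 * x - cc)| < L + hs}, ∑ i, (deriv (fun w => F (2 * (x : ℂ) - w)) w i) ^ 2 = 1) ∧
    ContDiff ℝ 1 (fun s : ℝ => X (2 * x - s)) ∧ (∀ τ, ‖deriv (fun s : ℝ => X (2 * x - s)) τ‖ = 1) ∧
    (∀ τ σ, ‖deriv (fun s : ℝ => X (2 * x - s)) τ - deriv (fun s : ℝ => X (2 * x - s)) σ‖ ≤ Rb) ∧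
    (∀ r : ℝ, (r : ℂ) ∈ {z : ℂ | |z.im| < hs ∧ |z.re - (2 * x - cc)| < L + hs} →
      (fun w => F (2 * (x : ℂ) - w)) r = fun i => ((⟪(fun s : ℝ => X (2 * x - s)) r, EuclideanSpace.single i (1:ℝ)⟫_ℝ : ℝ) : ℂ)) := by
  set S : Set ℂ := {z : ℂ | |z.im| < hs ∧ |z.re - cc| < L + hs} with hS
  set S' : Set ℂ := {z : ℂ | |z.im| < hs ∧ |z.re - (2 * x - cc)| < L + hs} with hS'
  have hSo : IsOpen S := isOpen_stadium hs (L + hs) cc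
  set ρ : ℂ → ℂ := fun w => 2 * (x : ℂ) - w with hρ
  have hρS : ∀ w, w ∈ S' ↔ ρ w ∈ S := fun w => (reflect_mem_iff w).symm
  have hρd : ∀ w, HasDerivAt ρ (-1) w := by
    intro w
    have h := ((hasDerivAt_id w).const_sub (2 * (x : ℂ)))
    simpa [hρ] using h
  have hF'd : DifferentiableOn ℂ (fun w => F (ρ w)) S' := by
    intro w hw
    have h1 : DifferentiableAt ℂ F (ρ w) := hF.differentiableAt (hSo.mem_nhds ((hρS w).1 hw))
    exact (h1.comp w (hρd w).differentiableAt).differentiableWithinAt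
  have hderiv : ∀ w, ρ w ∈ S → deriv (fun w => F (ρ w)) w = -deriv F (ρ w) := by
    intro w hw
    have h1 : HasDerivAt F (deriv F (ρ w)) (ρ w) := (hF.differentiableAt (hSo.mem_nhds hw)).hasDerivAt
    have h2 := h1.scomp w (hρd w)
    have h3 : deriv (fun w => F (ρ w)) w = ((-1 : ℂ) • deriv F (ρ w)) := h2.deriv
    rw [h3, neg_one_smul]
  -- the real curve
  have hXd : Differentiable ℝ X := hX.differentiable (by norm_num)
  have hρr : ∀ s : ℝ, HasDerivAt (fun s : ℝ => 2 * x - s) (-1) s := by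
    intro s
    have h := ((hasDerivAt_id s).const_sub (2 * x))
    simpa using h
  have hXderiv : ∀ s : ℝ, deriv (fun s : ℝ => X (2 * x - s)) s = -deriv X (2 * x - s) := by
    intro s
    have h1 : HasDerivAt X (deriv X (2 * x - s)) (2 * x - s) := (hXd _).hasDerivAt
    have h2 : HasDerivAt (fun s : ℝ => X (2 * x - s)) ((-1 : ℝ) • deriv X (2 * x - s)) s := h1.scomp s (hρr s)
    rw [h2.deriv, neg_one_smul]
  refine ⟨hF'd, ?_, ?_, ?_, ?_, ?_, ?_⟩
  · intro w hw
    show ‖deriv (fun w => F (ρ w)) w‖ ≤ 2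
    rw [hderiv w ((hρS w).1 hw), norm_neg]
    exact hM _ ((hρS w).1 hw)
  · intro w hw
    show ∑ i, (deriv (fun w => F (ρ w)) w i) ^ 2 = 1
    rw [hderiv w ((hρS w).1 hw)]
    simp only [Pi.neg_apply, neg_sq]
    exact hunit _ ((hρS w).1 hw)
  · exact hX.comp ((contDiff_const.sub contDiff_id))
  · intro τ; rw [hXderiv, norm_neg]; exact hXu _
  · intro τ σ
    rw [hXderiv, hXderiv, show -deriv X (2 * x - τ) - -deriv X (2 * x - σ) = -(deriv X (2 * x - τ) - deriv X (2 * x - σ)) by abel,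
      norm_neg]
    exact hosc _ _
  · intro r hr
    have h1 : ρ r = (((2 * x - r : ℝ)) : ℂ) := by simp [hρ]
    have h2 : (((2 * x - r : ℝ)) : ℂ) ∈ S := by rw [← h1]; exact (hρS r).1 hr
    show F (ρ r) = _
    rw [h1, hFX _ h2]

/-- **The reflected target and sources.**  Through `x = x₀`: `2x₀ − (x₀ + iY) = x₀ + i(−Y)` and `2x₀ − ((x₀ + a) + iη) = (x₀ + (−a)) + i(−η)` —
a target below the axis becomes one above it at the same abscissa; a source to the right becomes one to the left. [folklore] -/
theorem reflect_target (x₀ Y a η : ℝ) :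
    2 * (x₀ : ℂ) - ((x₀ : ℂ) + (Y : ℂ) * Complex.I) = (x₀ : ℂ) + ((-Y : ℝ) : ℂ) * Complex.I ∧
    2 * (x₀ : ℂ) - (((x₀ + a : ℝ) : ℂ) + (η : ℂ) * Complex.I) = ((x₀ + -a : ℝ) : ℂ) + ((-η : ℝ) : ℂ) * Complex.I := by
  constructor
  · push_cast; ring
  · push_cast; ring

/-- **The chord square is transported literally**: `Σᵢ ((F∘(2x−·))(ζ') − (F∘(2x−·))(z'))² = Σᵢ (F(2x−ζ') − F(2x−z'))²` (definitional) — so a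
certificate for the reflected data at `(z', ζ')` IS a certificate for `F` at `(2x − z', 2x − ζ')`. [folklore] -/
theorem reflect_chord_sq (F : ℂ → (Fin 3 → ℂ)) (x : ℝ) (z' ζ' : ℂ) :
    ∑ i, ((fun w => F (2 * (x : ℂ) - w)) ζ' i - (fun w => F (2 * (x : ℂ) - w)) z' i) ^ 2 =
      ∑ i, (F (2 * (x : ℂ) - ζ') i - F (2 * (x : ℂ) - z') i) ^ 2 := rfl

end Summit.NavierStokesRegularity.NavierStokesRegularity.Theorems.StadiumCornerTransport

end
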